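import Summits.ValiantsHypothesis.ValiantsHypothesis.Theorems.KPlusLogSqLawOctaveDepthAtoms

/-!
# Route «KPlusLogSqLaw», octave line — file 5a/7: breakpoints ⇒ a real chain (`designPiecesBound_of_realChainBound`) and the integerisation vocabulary (`ent`, `tieBreak`)

HONEST FRAMING.  Octave line of ideator seat val-idea-6 (crux-idea `octave-lifting` on stmt-ValiantsHypothesis-19561, critic-1 PASS 2026-08-27), published as `Cruxes/WeakLifting/Lines/octave.lean`; landed in Theorems shape by prover seat val-width-19561-oc1 (`--supports stmt-ValiantsHypothesis-19561`).  Conjecture B (`KPlusLogSqLaw`), `TropicalB` (stmt-19771), `WeakLifting` (stmt-19561), `MatrixDescartes` (stmt-18050) and the octave statements `OctaveWeakLifting` / `OctaveKLaw` / `OctaveMatrixDescartes` are OPEN and DEFINED, never asserted; nothing in this file proves any of them, and VP ≠ VNP is not moved.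

This file: `designPiecesBound_of_realChainBound` (sorted breakpoints, interleaved sample points, slope sandwich), `ent`, `eq_of_image_ent_eq`, `tieBreak`, `tieBreak_injective` (binary expansions, `Finset.equivBitIndices`), `tieBreak_lt`, `termSign_pattern_ne_zero_iff`, `rawSlope_le`, `rawLog_eq_sum`.
-/

set_option linter.dupNamespace false
set_option autoImplicit false

namespace Summit.ValiantsHypothesis.ValiantsHypothesis.Theorems.KPlusLogSqLaw.Octave

open Polynomial Finset
open scoped BigOperators
open Summit.ValiantsHypothesis.ValiantsHypothesis.Theorems.LacunarySymmetroidMatrixDescartes (RealRootLawAt KPlusLogSqLaw)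
open Summit.ValiantsHypothesis.ValiantsHypothesis.Theses.LacunarySymmetroid (MatrixDescartes PencilTransfer ThetaWitness)
open Summit.ValiantsHypothesis.ValiantsHypothesis.Theses.KPlusLogSqLaw (TropicalB WeakLifting)

section Depth

open Finset

variable {m K : ℕ}

/-- **breakpoints ⇒ a real chain** (PROVED): the design breakpoints, sorted, are interleaved by `#breaks + 1` points; top terms there
have strictly increasing slope classes. -/
theorem designPiecesBound_of_realChainBound (h : RealChainBound) : DesignPiecesBound := by
  intro m K n hH d S
  classical
  set B := designBreaks d S with hB
  set N := B.card with hN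
  rcases Nat.eq_zero_or_pos N with h0 | hNpos
  · rw [h0]; exact Nat.zero_le _
  -- present terms exist
  set P := (univ : Finset (RawTerm m K)).filter (fun τ => rawCoef S τ ≠ 0) with hP
  have hPne : P.Nonempty := by
    obtain ⟨b, hb⟩ := Finset.card_pos.1 hNpos
    rw [hB, designBreaks, Finset.mem_image] at hb
    obtain ⟨kl, hkl, -⟩ := hb
    rw [Finset.mem_filter] at hkl
    exact ⟨kl.1, by rw [hP, Finset.mem_filter]; exact ⟨mem_univ _, hkl.2.1⟩⟩
  -- sorted breakpoints
  let b : Fin N → ℝ := fun i => B.orderEmbOfFin hN.symm i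
  have hbmono : StrictMono b := fun i j hij => (B.orderEmbOfFin hN.symm).strictMono hij
  have hbmem : ∀ i, b i ∈ B := fun i => Finset.orderEmbOfFin_mem B hN.symm i
  -- interleaving points
  let β : ℕ → ℝ := fun i => if h : i < N then b ⟨i, h⟩ else b ⟨N - 1, by omega⟩ + 1
  let βL : ℕ → ℝ := fun j => if j = 0 then b ⟨0, hNpos⟩ - 1 else β (j - 1)
  let θ : Fin (N + 1) → ℝ := fun j => (βL j + β j) / 2
  have hβ_eq : ∀ i : Fin N, β i = b i := fun i => by simp [β, i.2]
  have hβL_lt : ∀ i : Fin N, βL i < b i := by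
    intro i
    by_cases hi : (i : ℕ) = 0
    · have : i = ⟨0, hNpos⟩ := Fin.ext hi
      simp [βL, this]
    · simp only [βL, hi, if_false]
      have hlt : (i : ℕ) - 1 < N := by omega
      simp only [β, hlt, dif_pos]
      exact hbmono (Fin.mk_lt_mk.2 (by omega) : (⟨(i : ℕ) - 1, hlt⟩ : Fin N) < ⟨i, i.2⟩)
  have hβ_gt : ∀ i : Fin N, b i < β ((i : ℕ) + 1) := by
    intro i
    by_cases hi : (i : ℕ) + 1 < N
    · simp only [β, hi, dif_pos]
      exact hbmono (Fin.mk_lt_mk.2 (by omega) : (⟨(i : ℕ), i.2⟩ : Fin N) < ⟨i + 1, hi⟩)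
    · simp only [β, hi, dif_neg, not_false_eq_true]
      have : i = ⟨N - 1, by omega⟩ := Fin.ext (by simp; omega)
      rw [← this]; linarith
  have hleft : ∀ i : Fin N, θ i.castSucc < b i := by
    intro i
    show (βL (i : ℕ) + β (i : ℕ)) / 2 < b i
    have := hβL_lt i; have := hβ_eq i; linarith
  have hright : ∀ i : Fin N, b i < θ i.succ := by
    intro i
    show b i < (βL ((i : ℕ) + 1) + β ((i : ℕ) + 1)) / 2
    have h1 : βL ((i : ℕ) + 1) = b i := by
      simp only [βL, Nat.add_one_ne_zero, if_false, Nat.add_sub_cancel]; exact hβ_eq i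
    have := hβ_gt i; linarith
  have hθmono : StrictMono θ := by
    refine Fin.strictMono_iff_lt_succ.2 fun i => ?_
    exact (hleft i).trans (hright i)
  -- top terms
  have htop : ∀ j : Fin (N + 1), ∃ t ∈ P, ∀ τ ∈ P, rawLine d S τ (θ j) ≤ rawLine d S t (θ j) :=
    fun j => Finset.exists_max_image P (fun τ => rawLine d S τ (θ j)) hPne
  choose t htP htmax using htop
  have hpres : ∀ j, rawCoef S (t j) ≠ 0 := fun j => by
    have := htP j; rw [hP, Finset.mem_filter] at this; exact this.2
  have hmax' : ∀ j τ, rawCoef S τ ≠ 0 → rawLine d S τ (θ j) ≤ rawLine d S (t j) (θ j) := fun j τ hτ =>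
    htmax j τ (by rw [hP, Finset.mem_filter]; exact ⟨mem_univ _, hτ⟩)
  -- slopes strictly increase across each breakpoint
  have hslope : StrictMono (fun j => rawSlope d (t j)) := by
    refine Fin.strictMono_iff_lt_succ.2 fun i => ?_
    have hb := hbmem i
    rw [hB, designBreaks, Finset.mem_image] at hb
    obtain ⟨kl, hkl, hc⟩ := hb
    rw [Finset.mem_filter] at hkl
    obtain ⟨-, hk, hl, hs, hall⟩ := hkl
    have hcross := rawLine_cross d S kl.1 kl.2 hs
    -- at c = b i : k on top (and l ties with k)
    have htopk : ∀ τ, rawCoef S τ ≠ 0 → rawLine d S τ (b i) ≤ rawLine d S kl.1 (b i) := fun τ hτ => by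
      have := hall τ hτ; rw [hc] at this; simpa [rawLine] using this
    have htopl : ∀ τ, rawCoef S τ ≠ 0 → rawLine d S τ (b i) ≤ rawLine d S kl.2 (b i) := fun τ hτ => by
      have h1 := htopk τ hτ
      have h2 : rawLine d S kl.1 (b i) = rawLine d S kl.2 (b i) := by rw [← hc]; exact hcross
      linarith
    have a1 : rawSlope d (t i.castSucc) ≤ rawSlope d kl.1 :=
      slope_le_of_top_left (hleft i) (hmax' _ kl.1 hk) (htopk _ (hpres _))
    have a2 : rawSlope d (t i.castSucc) ≤ rawSlope d kl.2 :=
      slope_le_of_top_left (hleft i) (hmax' _ kl.2 hl) (htopl _ (hpres _))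
    have a3 : rawSlope d kl.1 ≤ rawSlope d (t i.succ) :=
      le_slope_of_top_right (hright i) (hmax' _ kl.1 hk) (htopk _ (hpres _))
    have a4 : rawSlope d kl.2 ≤ rawSlope d (t i.succ) :=
      le_slope_of_top_right (hright i) (hmax' _ kl.2 hl) (htopl _ (hpres _))
    show rawSlope d (t i.castSucc) < rawSlope d (t i.succ)
    rcases lt_or_gt_of_ne hs with h | h <;> omega
  -- the sample points are not breakpoints, so ties there stay inside one slope class
  have HL : ∀ (j : Fin (N + 1)) (i : Fin N), (i : ℕ) < j → b i < θ j := by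
    intro j i hij
    refine (hright i).trans_le (hθmono.monotone ?_)
    exact Fin.le_iff_val_le_val.2 (by simp; omega)
  have HR : ∀ (j : Fin (N + 1)) (i : Fin N), (j : ℕ) ≤ i → θ j < b i := by
    intro j i hji
    refine lt_of_le_of_lt (hθmono.monotone ?_) (hleft i)
    exact Fin.le_iff_val_le_val.2 (by simp; omega)
  have hnot : ∀ j, θ j ∉ B := by
    intro j hj
    have hr : θ j ∈ Set.range (B.orderEmbOfFin hN.symm) := by rw [Finset.range_orderEmbOfFin]; exact hj
    obtain ⟨i, hi⟩ := hr
    change b i = θ j at hi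
    rcases lt_or_ge (i : ℕ) (j : ℕ) with hij | hji
    · exact absurd hi (HL j i hij).ne
    · exact absurd hi (HR j i hji).ne'
  have htie : ∀ j τ, rawCoef S τ ≠ 0 → rawLine d S τ (θ j) = rawLine d S (t j) (θ j) → rawSlope d τ = rawSlope d (t j) := by
    intro j τ hτ heq
    by_contra hs
    apply hnot j
    rw [hB, designBreaks, Finset.mem_image]
    refine ⟨(t j, τ), ?_, rawCross_eq_of_tie d S (t j) τ (Ne.symm hs) heq.symm⟩
    rw [Finset.mem_filter]
    refine ⟨mem_univ _, hpres j, hτ, Ne.symm hs, fun t' ht' => ?_⟩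
    rw [rawCross_eq_of_tie d S (t j) τ (Ne.symm hs) heq.symm]
    have := hmax' j t' ht'
    simpa [rawLine] using this
  exact h m K n hH d S N θ t hθmono hpres hmax' htie hslope

/-! ### Integerisation: real chains obey the integer tropical row (`RealChainBound`, PROVED) -/

section Integerisation

open Summit.ValiantsHypothesis.ValiantsHypothesis.Theorems.MatrixDescartes.Negative (termSign IsDominant tropWeight)
open Summit.ValiantsHypothesis.ValiantsHypothesis.Theorems.KPlusLogSqLaw (TropRowD DesignRowD)

/-- entries `(row, column, letter)` used by a raw term. -/
def ent (τ : RawTerm m K) (i : Fin m) : Fin m × Fin m × Fin K := (τ.1 i, i, τ.2 i)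

/-- a raw term uses one entry per column, so its entry map is injective. [folklore] -/
theorem ent_injective (τ : RawTerm m K) : Function.Injective (ent τ) := fun i j h => by
  have := congrArg (fun e => e.2.1) h
  simpa [ent] using this

/-- a raw term is determined by its set of entries. [folklore] -/
theorem eq_of_image_ent_eq {τ τ' : RawTerm m K} (h : univ.image (ent τ) = univ.image (ent τ')) : τ = τ' := by
  classical
  have key : ∀ i, τ.1 i = τ'.1 i ∧ τ.2 i = τ'.2 i := by
    intro i
    have hi : ent τ i ∈ univ.image (ent τ') := by rw [← h]; exact mem_image_of_mem _ (mem_univ i)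
    obtain ⟨i', -, hi'⟩ := mem_image.1 hi
    simp only [ent, Prod.mk.injEq] at hi'
    obtain ⟨h1, h2, h3⟩ := hi'
    subst h2
    exact ⟨h1.symm, h3.symm⟩
  refine Prod.ext (Equiv.ext fun i => (key i).1) (funext fun i => (key i).2)

/-- binary (lexicographic) tie-breaker of a raw term w.r.t. an indexing of the entries. -/
def tieBreak (idx : Fin m × Fin m × Fin K → ℕ) (τ : RawTerm m K) : ℕ := ∑ i, 2 ^ idx (ent τ i)

/-- the tie-breaker as a sum of DISTINCT powers of two over the image of the entry set. [folklore] -/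
theorem tieBreak_eq_sum_image (idx : Fin m × Fin m × Fin K → ℕ) (hidx : Function.Injective idx) (τ : RawTerm m K) :
    tieBreak idx τ = ∑ k ∈ (univ.image (ent τ)).image idx, 2 ^ k := by
  classical
  rw [tieBreak, Finset.sum_image (fun a _ b _ h => hidx h), Finset.sum_image (fun a _ b _ h => ent_injective τ h)]

/-- distinct raw terms have distinct tie-breakers (binary expansions are unique: `Finset.equivBitIndices`). -/
theorem tieBreak_injective (idx : Fin m × Fin m × Fin K → ℕ) (hidx : Function.Injective idx) :
    Function.Injective (tieBreak (m := m) (K := K) idx) := by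
  classical
  intro τ τ' h
  rw [tieBreak_eq_sum_image idx hidx, tieBreak_eq_sum_image idx hidx] at h
  have key : ∀ s : Finset ℕ, Finset.equivBitIndices.symm s = ∑ i ∈ s, 2 ^ i := fun s => rfl
  rw [← key, ← key] at h
  have h2 := Finset.equivBitIndices.symm.injective h
  exact eq_of_image_ent_eq (Finset.image_injective hidx h2)

/-- `Σ_{k<W} 2^k < 2^W`. [folklore] -/
theorem sum_range_two_pow_lt (W : ℕ) : ∑ k ∈ range W, 2 ^ k < 2 ^ W := by
  induction W with
  | zero => simp
  | succ n ih => rw [Finset.sum_range_succ, pow_succ]; omega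

/-- the tie-breaker is below `2^W` when all indices are `< W`. [folklore] -/
theorem tieBreak_lt (idx : Fin m × Fin m × Fin K → ℕ) (hidx : Function.Injective idx) (W : ℕ) (hW : ∀ e, idx e < W)
    (τ : RawTerm m K) : tieBreak idx τ < 2 ^ W := by
  classical
  rw [tieBreak_eq_sum_image idx hidx]
  refine lt_of_le_of_lt (Finset.sum_le_sum_of_subset fun k hk => ?_) (sum_range_two_pow_lt W)
  obtain ⟨e, -, rfl⟩ := mem_image.1 hk
  exact mem_range.2 (hW e)

/-- presence: the 0/1 pattern of `S` marks exactly the raw terms with nonzero value. -/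
theorem termSign_pattern_ne_zero_iff (S : Fin K → Matrix (Fin m) (Fin m) ℝ) (τ : RawTerm m K) :
    termSign (fun a b l => if S l a b = 0 then (0 : ℤ) else 1) τ ≠ 0 ↔ rawCoef S τ ≠ 0 := by
  rw [termSign, rawCoef, mul_ne_zero_iff, mul_ne_zero_iff, Finset.prod_ne_zero_iff, Finset.prod_ne_zero_iff]
  have h1 : ((Equiv.Perm.sign τ.1 : ℤ)) ≠ 0 := Units.ne_zero _
  have h2 : (((Equiv.Perm.sign τ.1 : ℤ)) : ℝ) ≠ 0 := by exact_mod_cast h1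
  simp only [h1, h2, ne_eq, mem_univ, true_implies, ite_eq_left_iff, one_ne_zero, imp_false, not_not]

/-- slope classes are bounded by `m · Σ_l d_l`. -/
theorem rawSlope_le (d : Fin K → ℕ) (τ : RawTerm m K) : rawSlope d τ ≤ m * ∑ l, d l := by
  rw [rawSlope]
  calc ∑ i, d (τ.2 i) ≤ ∑ _i : Fin m, ∑ l, d l :=
        Finset.sum_le_sum fun i _ => Finset.single_le_sum (f := d) (fun l _ => Nat.zero_le _) (mem_univ (τ.2 i))
    _ = m * ∑ l, d l := by rw [Finset.sum_const, card_univ, Fintype.card_fin, smul_eq_mul]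

/-- log of a present raw term = sum of the entry logs. -/
theorem rawLog_eq_sum (S : Fin K → Matrix (Fin m) (Fin m) ℝ) (τ : RawTerm m K) (hτ : rawCoef S τ ≠ 0) :
    rawLog S τ = ∑ i, Real.logb 2 |S (τ.2 i) (τ.1 i) i| := by
  have habs : |rawCoef S τ| = ∏ i, |S (τ.2 i) (τ.1 i) i| := by
    rw [rawCoef, abs_mul, ← Finset.abs_prod]
    have : |((Equiv.Perm.sign τ.1 : ℤ) : ℝ)| = 1 := by
      rcases Int.units_eq_one_or (Equiv.Perm.sign τ.1) with h | h <;> simp [h]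
    rw [this, one_mul]
  have hne : ∀ i, S (τ.2 i) (τ.1 i) i ≠ 0 := by
    have := hτ; rw [rawCoef, mul_ne_zero_iff, Finset.prod_ne_zero_iff] at this
    exact fun i => this.2 i (mem_univ i)
  rw [rawLog, habs, Real.logb_prod]
  exact fun i _ => abs_ne_zero.2 (hne i)

end Integerisation

end Depth

end Summit.ValiantsHypothesis.ValiantsHypothesis.Theorems.KPlusLogSqLaw.Octave
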